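import Literature.NumberTheory.EllipticCurves.CongruentNumberCurveLValueKronecker
import HarnessLib

/-!
# `L(E_1, 1)` for `y² = x³ - x` through ONE Eisenstein–Kronecker number: the primary-coset form

Topic `Literature/NumberTheory/EllipticCurves`, the Tunnell / Birch–Swinnerton-Dyer cluster,
companion of `CongruentNumberCurveLValueKronecker` (which writes `L(E_n, 1)` as the sum of
`ψ_n(c) conj(E₁*(c/M))` over ALL classes `c` modulo a period `M` of `ψ_n`). For
`E_1 : y² = x³ - x` (`congruentNumberCurve 1`) the Hecke coefficient is `ψ_1(x) x = primary x`, and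
folding the four unit multiples of each primary Gaussian integer onto the single coset
`1 + (2+2i)ℤ[i]` of primary elements gives the value through ONE division point:

  `L(E_1, 1) = (ζ_{ℤi+ℤ}((1+i)/4) - π (1-i)/4) / (2 - 2i)`

(`entireLFunction_congruentNumberCurve_one_eq`; `ζ_{ℤi+ℤ}` the Weierstrass zeta function of the
Gaussian lattice, `PeriodPair.weierstrassZeta` of `PeriodPair.ofUpperHalfPlane I`; the bracket is
`E₁*((1+i)/4)`, `GaussianLattice.kroneckerE₁`). The sibling `CongruentNumberCurveLValueOne`
evaluates the right side (`= β/4`, Birch–Swinnerton-Dyer 1965, Table 1, `σ(1) = ¼`; Tunnell 1983,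
p. 329). Everything here is proved; no definitions, no named facts.

## The chain (all proved in the tree)

* `entireLFunction_congruentNumberCurve_eq_of_period` (`CongruentNumberCurveLValueKronecker`) —
  `L(E_n, s) = ¼ Θ-L_{ψ_n}(s)` for all `s`, and `GaussianTheta.tendsto_tsum_thetaLFunction_one`
  (`GaussianThetaLValueOne`) — `Θ-L_ψ(1) = lim_{y→0⁺} ∑_x ψ(x) (x/N x) e^{-y N x}`;
* `hasSum_comp_primary` — **folding the four units**:
  `∑_{x ∈ ℤ[i]} G(primary x) = 4 ∑_{μ} G(1 + (2+2i)μ)` (the primary elements are exactly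
  `1 + (2+2i)ℤ[i]`, Ireland–Rosen Ch. 9 §7 Lemma 6, and every odd `x` has exactly the four
  associates `u · primary x`, `u ∈ {1, i, -1, -i}`, Lemma 7);
* for `ψ = ψ_1` the summand is `G_y(primary x)` with `G_y(α) = (α / N α) e^{-y N α} = e^{-y|α|²}/ᾱ`,
  and `ᾱ = (2-2i)((1+i)/4 + μ̄)` for `α = 1 + (2+2i)μ`, so that `∑_μ G_y(1 + (2+2i)μ)` is
  `(2-2i)⁻¹` times the Gauss-damped Eisenstein sum of weight one at `z = (1+i)/4` with parameter
  `8y`, whose limit is `ζ(z) - π z̄` by Kronecker's limit formula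
  `GaussianLattice.tendsto_tsum_exp_div_sub` (`GaussianLatticeKroneckerLimit`).

## References

* B. J. Birch, H. P. F. Swinnerton-Dyer, *Notes on elliptic curves. II*, J. reine angew. Math.
  218 (1965) 79–108, §3 and Table 1.
* K. Ireland, M. Rosen, *A Classical Introduction to Modern Number Theory*, GTM 84, Ch. 9 §7
  (primary Gaussian integers, Lemmas 6–7), Ch. 18 §6–§7 (`L(E, s) = L(s, χ)`).
* J. B. Tunnell, Invent. Math. 72 (1983), p. 329 (`L(E, 1)/β = ¼`).
-/

noncomputable section

open scoped ComplexConjugate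
open UpperHalfPlane hiding I
open Complex Real Filter Topology PeriodPair WeierstrassCurve
open Literature.NumberTheory.LFunctions Literature.NumberTheory.QuadraticFields

namespace Literature.NumberTheory.EllipticCurves

/-! ### `4 L(E_1, 1)` as a Gauss-damped limit -/

/-- **`4 L(E_1, 1) = lim_{y → 0⁺} ∑_{x ∈ ℤ[i]} ψ_1(x) (x/N x) e^{-y N x}`**
(`entireLFunction_congruentNumberCurve_eq_of_period` at `n = 1`, `M = 4`, `s = 1`, with
`GaussianTheta.tendsto_tsum_thetaLFunction_one`). [folklore] -/
theorem tendsto_tsum_heckePsi_one :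
    Tendsto (fun y : ℝ ↦ ∑' x : GaussianInt, heckePsi 1 x * (x : ℂ) / ((x.norm : ℤ) : ℂ) *
      ((rexp (-y * ((x.norm : ℤ) : ℝ)) : ℝ) : ℂ)) (𝓝[>] 0)
      (𝓝 (4 * (congruentNumberCurve 1).entireLFunction 1)) := by
  haveI : NeZero (4 * 1) := ⟨by norm_num⟩
  have h := GaussianTheta.tendsto_tsum_thetaLFunction_one (4 * 1) (heckePsi 1) (heckePsi_add_mul 1)
  rw [entireLFunction_congruentNumberCurve_eq_of_period squarefree_one (4 * 1) (heckePsi_add_mul 1) 1]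
  convert h using 2
  ring

/-! ### The summand for `n = 1`: `ψ_1(x) x = primary x` -/

/-- The Gauss-damped term `G_y(α) = (α / N α) e^{-y N α}`, at `α = primary x`, is the summand of
`tendsto_tsum_heckePsi_one`: `ψ_1(x) x = primary x` and `N(primary x) = N x` for odd `x`, both
sides vanish for even `x`. [folklore] -/
theorem heckePsi_one_term_eq (y : ℝ) (x : GaussianInt) :
    heckePsi 1 x * (x : ℂ) / ((x.norm : ℤ) : ℂ) * ((rexp (-y * ((x.norm : ℤ) : ℝ)) : ℝ) : ℂ) =
      ((GaussianPrimary.primary x : GaussianInt) : ℂ) /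
          (((GaussianPrimary.primary x).norm : ℤ) : ℂ) *
        ((rexp (-y * (((GaussianPrimary.primary x).norm : ℤ) : ℝ)) : ℝ) : ℂ) := by
  rw [heckePsi_mul_self, Nat.cast_one, jacobiSym.one_left, Int.cast_one, one_mul]
  by_cases hodd : (x.re + x.im) % 2 = 1
  · rw [GaussianPrimary.norm_primary hodd]
  · rw [GaussianPrimary.primary_eq_zero_of_even (by omega)]
    simp

/-! ### Folding the four units: `∑_x G(primary x) = 4 ∑_μ G(1 + (2+2i)μ)` -/

/-- `1 + (2+2i)μ` is primary. [folklore] -/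
theorem isPrimary_one_add (μ : GaussianInt) : GaussianPrimary.IsPrimary (1 + ⟨2, 2⟩ * μ) :=
  (GaussianPrimary.isPrimary_iff_dvd _).mpr ⟨μ, by ring⟩

/-- A primary element is of the form `1 + (2+2i)μ`. [folklore] -/
theorem exists_eq_one_add_of_isPrimary {α : GaussianInt} (h : GaussianPrimary.IsPrimary α) :
    ∃ μ : GaussianInt, α = 1 + ⟨2, 2⟩ * μ := by
  obtain ⟨μ, hμ⟩ := (GaussianPrimary.isPrimary_iff_dvd α).mp h
  exact ⟨μ, by rw [← hμ]; ring⟩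

/-- The four units `1, i, -1, -i` of `ℤ[i]`, as a table (each entry is the INVERSE of the
corresponding unit in `GaussianPrimary.eq_of_isUnit`'s order `1, -1, i, -i` up to reindexing).
[folklore] -/
theorem isUnit_units_table (k : Fin 4) :
    IsUnit ((![1, ⟨0, 1⟩, ⟨-1, 0⟩, ⟨0, -1⟩] : Fin 4 → GaussianInt) k) := by
  have hneg1 : (⟨-1, 0⟩ : GaussianInt) = -1 := by ext <;> rfl
  have hnegI : (⟨0, -1⟩ : GaussianInt) = -⟨0, 1⟩ := by ext <;> rfl
  fin_cases k
  · exact isUnit_one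
  · exact GaussianPrimary.isUnit_I
  · simp only [Fin.reduceFinMk, Matrix.cons_val]; rw [hneg1]; exact isUnit_one.neg
  · simp only [Fin.reduceFinMk, Matrix.cons_val]; rw [hnegI]; exact GaussianPrimary.isUnit_I.neg

/-- The table of units is injective. [folklore] -/
theorem units_table_injective :
    Function.Injective ((![1, ⟨0, 1⟩, ⟨-1, 0⟩, ⟨0, -1⟩] : Fin 4 → GaussianInt)) := by
  decide

/-- Summing a summable family over `{0,1,2,3} × ℤ[i]`, constant in the first variable,
multiplies the sum by `4`. [folklore] -/
theorem hasSum_four_mul {g : GaussianInt → ℂ} {S : ℂ} (hS : HasSum g S)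
    (hn : Summable fun μ : GaussianInt ↦ ‖g μ‖) :
    HasSum (fun p : Fin 4 × GaussianInt ↦ g p.2) (4 * S) := by
  have h4 : HasSum (fun _ : Fin 4 ↦ (1 : ℂ)) 4 := by
    have := hasSum_fintype (fun _ : Fin 4 ↦ (1 : ℂ))
    simpa using this
  have hn1 : Summable fun _ : Fin 4 ↦ ‖(1 : ℂ)‖ := (hasSum_fintype _).summable
  have hfg := summable_mul_of_summable_norm (f := fun _ : Fin 4 ↦ (1 : ℂ)) (g := g) hn1 hn
  have hprod := h4.mul hS hfg
  refine hprod.congr_fun fun p ↦ ?_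
  simp only [one_mul]

/-- **Folding the four units.** For `G : ℤ[i] → ℂ` with `G 0 = 0`, if `∑_μ G(1 + (2+2i)μ)`
converges absolutely with sum `S`, then `∑_{x ∈ ℤ[i]} G(primary x) = 4S`: the map
`(u, μ) ↦ u (1 + (2+2i)μ)`, `u` a unit, is a bijection from `{1, i, -1, -i} × ℤ[i]` onto the odd
Gaussian integers, `primary (u α) = α` for `α` primary (Ireland–Rosen Ch. 9 §7, Lemmas 6–7), and
`primary x = 0` for even `x`. [folklore] -/
theorem hasSum_comp_primary {G : GaussianInt → ℂ} (hG0 : G 0 = 0) {S : ℂ}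
    (hS : HasSum (fun μ : GaussianInt ↦ G (1 + ⟨2, 2⟩ * μ)) S)
    (hn : Summable fun μ : GaussianInt ↦ ‖G (1 + ⟨2, 2⟩ * μ)‖) :
    HasSum (fun x : GaussianInt ↦ G (GaussianPrimary.primary x)) (4 * S) := by
  -- the parametrisation of the odd elements
  set u : Fin 4 → GaussianInt := ![1, ⟨0, 1⟩, ⟨-1, 0⟩, ⟨0, -1⟩] with hu
  set e : Fin 4 × GaussianInt → GaussianInt := fun p ↦ u p.1 * (1 + ⟨2, 2⟩ * p.2) with he
  have hτ : (⟨2, 2⟩ : GaussianInt) ≠ 0 := by decide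
  have hprim : ∀ p : Fin 4 × GaussianInt,
      GaussianPrimary.primary (e p) = 1 + ⟨2, 2⟩ * p.2 := fun p ↦ by
    rw [he, GaussianPrimary.primary_isUnit_mul (isUnit_units_table _),
      GaussianPrimary.primary_of_isPrimary (isPrimary_one_add _)]
  have hinj : Function.Injective e := by
    rintro ⟨k, μ⟩ ⟨k', μ'⟩ h
    have h1 : 1 + (⟨2, 2⟩ : GaussianInt) * μ = 1 + ⟨2, 2⟩ * μ' := by
      have := congrArg GaussianPrimary.primary h
      rwa [hprim, hprim] at this
    have hμ : μ = μ' := mul_left_cancel₀ hτ (add_left_cancel h1)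
    subst hμ
    have hα : (1 + (⟨2, 2⟩ : GaussianInt) * μ) ≠ 0 := (isPrimary_one_add μ).ne_zero
    have h2 : u k = u k' := by
      simp only [he] at h
      exact mul_right_cancel₀ hα h
    have hk : k = k' := units_table_injective h2
    rw [hk]
  have hsupp : ∀ x ∉ Set.range e, G (GaussianPrimary.primary x) = 0 := by
    intro x hx
    by_cases hodd : (x.re + x.im) % 2 = 1
    · exfalso
      apply hx
      obtain ⟨v, hv, hvx⟩ := GaussianPrimary.exists_isUnit_primary_eq hodd
      obtain ⟨μ, hμ⟩ := exists_eq_one_add_of_isPrimary (GaussianPrimary.isPrimary_primary hodd)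
      -- `primary x = v x = 1 + (2+2i)μ`, so `x = v⁻¹ (1 + (2+2i)μ) = u_k (1 + (2+2i)μ)`
      rw [hμ] at hvx
      rcases GaussianPrimary.eq_of_isUnit hv with rfl | rfl | rfl | rfl
      · refine ⟨(0, μ), ?_⟩
        show u 0 * (1 + ⟨2, 2⟩ * μ) = x
        rw [hvx, ← mul_assoc, show u 0 * 1 = 1 by rw [hu]; rfl, one_mul]
      · refine ⟨(2, μ), ?_⟩
        show u 2 * (1 + ⟨2, 2⟩ * μ) = x
        have h2 : u 2 * -1 = 1 := by rw [hu]; decide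
        rw [hvx, ← mul_assoc, h2, one_mul]
      · refine ⟨(3, μ), ?_⟩
        show u 3 * (1 + ⟨2, 2⟩ * μ) = x
        have h3 : u 3 * ⟨0, 1⟩ = 1 := by rw [hu]; decide
        rw [hvx, ← mul_assoc, h3, one_mul]
      · refine ⟨(1, μ), ?_⟩
        show u 1 * (1 + ⟨2, 2⟩ * μ) = x
        have h1 : u 1 * ⟨0, -1⟩ = 1 := by rw [hu]; decide
        rw [hvx, ← mul_assoc, h1, one_mul]
    · rw [GaussianPrimary.primary_eq_zero_of_even (by omega), hG0]
  -- the sum over `Fin 4 × ℤ[i]`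
  have hprod := hasSum_four_mul hS hn
  have hcomp : HasSum ((fun x ↦ G (GaussianPrimary.primary x)) ∘ e) (4 * S) := by
    refine hprod.congr_fun fun p ↦ ?_
    simp only [Function.comp_apply, hprim]
  exact (hinj.hasSum_iff hsupp).mp hcomp

/-! ### The primary sum as a Gauss-damped Eisenstein sum on `ℤi + ℤ` -/

/-- `N(α)` as a complex number is `α ᾱ`. [folklore] -/
theorem intCast_norm_eq_mul_conj (α : GaussianInt) :
    ((α.norm : ℤ) : ℂ) = (α : ℂ) * conj (α : ℂ) := by
  rw [Complex.mul_conj, ← GaussianInt.intCast_real_norm, Complex.ofReal_intCast]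

/-- The Gauss-damped term is `e^{-y|α|²}/ᾱ`. [folklore] -/
theorem term_eq_exp_div_conj (y : ℝ) (α : GaussianInt) :
    (α : ℂ) / ((α.norm : ℤ) : ℂ) * ((rexp (-y * ((α.norm : ℤ) : ℝ)) : ℝ) : ℂ) =
      ((rexp (-y * ‖(α : ℂ)‖ ^ 2) : ℝ) : ℂ) / conj (α : ℂ) := by
  rw [← norm_toComplex_sq, intCast_norm_eq_mul_conj]
  rcases eq_or_ne (α : ℂ) 0 with h | h
  · rw [h]; simp
  · have hc : conj (α : ℂ) ≠ 0 := (map_ne_zero _).mpr h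
    field_simp

/-- The conjugate of `1 + (2+2i)μ` is `(2-2i)((1+i)/4 + μ̄)`. [folklore] -/
theorem conj_one_add (μ : GaussianInt) :
    conj (((1 + ⟨2, 2⟩ * μ : GaussianInt) : ℂ)) = (2 - 2 * I) * ((1 + I) / 4 + conj (μ : ℂ)) := by
  have h22 : (((⟨2, 2⟩ : GaussianInt) : ℂ)) = 2 + 2 * I := by
    rw [GaussianInt.toComplex_def']; push_cast; ring
  simp only [map_add, map_one, map_mul, h22, map_ofNat, Complex.conj_I]
  linear_combination (1 / 2 : ℂ) * I_sq

/-- The bijection `μ ↦ -μ̄` from `ℤ[i]` onto the lattice `ℤi + ℤ` (as complex numbers).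
[folklore] -/
theorem exists_equiv_neg_conj :
    ∃ e : GaussianInt ≃ (ofUpperHalfPlane UpperHalfPlane.I).lattice,
      ∀ μ, ((e μ : (ofUpperHalfPlane UpperHalfPlane.I).lattice) : ℂ) = -conj (μ : ℂ) := by
  let e₁ : GaussianInt ≃ ℤ × ℤ :=
    { toFun := fun x ↦ (x.im, -x.re)
      invFun := fun p ↦ ⟨-p.2, p.1⟩
      left_inv := fun x ↦ Zsqrtd.ext (neg_neg _) rfl
      right_inv := fun p ↦ Prod.ext rfl (neg_neg _) }
  refine ⟨e₁.trans (ofUpperHalfPlane UpperHalfPlane.I).latticeEquivProd.symm.toEquiv, fun μ ↦ ?_⟩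
  rw [Equiv.trans_apply, LinearEquiv.coe_toEquiv, GaussianLattice.coe_latticeEquivProd_symm]
  simp only [e₁, Equiv.coe_fn_mk, GaussianInt.toComplex_def, map_add, map_mul, map_intCast,
    Complex.conj_I]
  push_cast
  ring

/-- **The primary sum is a Gauss-damped Eisenstein sum of weight one at `(1+i)/4`.** For
`y > 0`,
`∑_μ G_y(1 + (2+2i)μ) = (2-2i)⁻¹ ∑_{l ∈ ℤi+ℤ} e^{-8y|z-l|²}/(z-l)`, `z = (1+i)/4`. [folklore] -/
theorem tsum_term_one_add_eq (y : ℝ) :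
    ∑' μ : GaussianInt, (((1 + ⟨2, 2⟩ * μ : GaussianInt) : ℂ)) /
        ((((1 + ⟨2, 2⟩ * μ : GaussianInt)).norm : ℤ) : ℂ) *
        ((rexp (-y * ((((1 + ⟨2, 2⟩ * μ : GaussianInt)).norm : ℤ) : ℝ)) : ℝ) : ℂ) =
      (2 - 2 * I)⁻¹ * ∑' l : (ofUpperHalfPlane UpperHalfPlane.I).lattice,
        ((rexp (-(8 * y) * ‖(1 + I) / 4 - (l : ℂ)‖ ^ 2) : ℝ) : ℂ) / ((1 + I) / 4 - l) := by
  obtain ⟨e, he⟩ := exists_equiv_neg_conj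
  rw [← tsum_mul_left, ← e.tsum_eq]
  refine tsum_congr fun μ ↦ ?_
  rw [term_eq_exp_div_conj, he, sub_neg_eq_add]
  have hnorm : ‖(((1 + ⟨2, 2⟩ * μ : GaussianInt)) : ℂ)‖ ^ 2 =
      8 * ‖(1 + I) / 4 + conj (μ : ℂ)‖ ^ 2 := by
    rw [← Complex.norm_conj, conj_one_add, norm_mul, mul_pow]
    congr 1
    rw [Complex.sq_norm, Complex.normSq_apply]
    simp
    norm_num
  rw [hnorm, conj_one_add,
    show -(8 * y) * ‖(1 + I) / 4 + conj (μ : ℂ)‖ ^ 2 = -y * (8 * ‖(1 + I) / 4 + conj (μ : ℂ)‖ ^ 2) by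
      ring, div_eq_mul_inv, mul_inv, div_eq_mul_inv]
  ring

/-- `y ↦ 8y` maps `0⁺` to `0⁺`. [folklore] -/
theorem tendsto_eight_mul_nhdsGT_zero : Tendsto (fun y : ℝ ↦ 8 * y) (𝓝[>] 0) (𝓝[>] 0) := by
  have h := GaussianLattice.tendsto_div_const_nhdsGT_zero (c := 1 / 8) (by norm_num)
  refine h.congr fun y ↦ ?_
  ring

/-- **Limit of the primary sum**: `∑_μ G_y(1 + (2+2i)μ) → (ζ((1+i)/4) - π (1-i)/4)/(2-2i)` as
`y → 0⁺` (Kronecker's limit formula `GaussianLattice.tendsto_tsum_exp_div_sub` at `z = (1+i)/4`,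
`z̄ = (1-i)/4`). [folklore] -/
theorem tendsto_tsum_term_one_add :
    Tendsto (fun y : ℝ ↦ ∑' μ : GaussianInt, (((1 + ⟨2, 2⟩ * μ : GaussianInt) : ℂ)) /
        ((((1 + ⟨2, 2⟩ * μ : GaussianInt)).norm : ℤ) : ℂ) *
        ((rexp (-y * ((((1 + ⟨2, 2⟩ * μ : GaussianInt)).norm : ℤ) : ℝ)) : ℝ) : ℂ)) (𝓝[>] 0)
      (𝓝 ((2 - 2 * I)⁻¹ * ((ofUpperHalfPlane UpperHalfPlane.I).weierstrassZeta ((1 + I) / 4) -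
        π * ((1 - I) / 4)))) := by
  have h := ((GaussianLattice.tendsto_tsum_exp_div_sub ((1 + I) / 4)).comp
    tendsto_eight_mul_nhdsGT_zero).const_mul (2 - 2 * I)⁻¹
  have hconj : conj ((1 + I) / 4 : ℂ) = (1 - I) / 4 := by
    rw [map_div₀, map_add, map_one, Complex.conj_I, Complex.conj_ofNat]; ring
  rw [hconj] at h
  refine h.congr fun y ↦ ?_
  rw [Function.comp_apply, tsum_term_one_add_eq]

/-! ### Summability of the primary sum -/

/-- `‖G_y(α)‖ ≤ e^{-y N α}` (`G_y(α) = e^{-y|α|²}/ᾱ`, `|α| ≥ 1` or `α = 0`). [folklore] -/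
theorem norm_term_le (y : ℝ) (α : GaussianInt) :
    ‖(α : ℂ) / ((α.norm : ℤ) : ℂ) * ((rexp (-y * ((α.norm : ℤ) : ℝ)) : ℝ) : ℂ)‖ ≤
      rexp (-y * ((α.norm : ℤ) : ℝ)) := by
  rcases eq_or_ne α 0 with rfl | hα
  · simp
  · have hN1 : (1 : ℝ) ≤ ((α.norm : ℤ) : ℝ) := by exact_mod_cast GaussianInt.norm_pos.mpr hα
    have hn : ‖(α : ℂ)‖ ^ 2 = ((α.norm : ℤ) : ℝ) := norm_toComplex_sq α
    have hα1 : 1 ≤ ‖(α : ℂ)‖ := by nlinarith [norm_nonneg (α : ℂ)]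
    rw [norm_mul, norm_div, Complex.norm_real, Real.norm_eq_abs, abs_of_pos (Real.exp_pos _),
      Complex.norm_intCast, abs_of_pos (by linarith : (0 : ℝ) < (α.norm : ℤ)), ← hn]
    refine mul_le_of_le_one_left (Real.exp_pos _).le ?_
    rw [div_le_one (by positivity)]
    nlinarith

/-- `N(1 + (2+2i)μ) ≥ 4 N(μ) - 1`. [folklore] -/
theorem norm_one_add_ge (μ : GaussianInt) :
    4 * ((μ.norm : ℤ) : ℝ) - 1 ≤ (((1 + ⟨2, 2⟩ * μ : GaussianInt).norm : ℤ) : ℝ) := by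
  rw [← norm_toComplex_sq, ← norm_toComplex_sq, ← Complex.norm_conj
    (((1 + ⟨2, 2⟩ * μ : GaussianInt) : ℂ)), conj_one_add, norm_mul, mul_pow]
  have h8 : ‖(2 - 2 * I : ℂ)‖ ^ 2 = 8 := by
    rw [Complex.sq_norm, Complex.normSq_apply]; simp; norm_num
  rw [h8]
  have h := GaussianLattice.norm_sq_le_two_mul (-((1 + I) / 4)) (conj (μ : ℂ))
  rw [Complex.norm_conj, show -((1 + I) / 4) - conj (μ : ℂ) = -((1 + I) / 4 + conj (μ : ℂ)) by ring,
    norm_neg, norm_neg] at h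
  have hz : ‖((1 + I) / 4 : ℂ)‖ ^ 2 = 1 / 8 := by
    rw [Complex.sq_norm, Complex.normSq_apply]; simp; norm_num
  rw [hz] at h
  linarith

/-- The primary sum converges absolutely (`y > 0`). [folklore] -/
theorem summable_norm_term_one_add {y : ℝ} (hy : 0 < y) :
    Summable fun μ : GaussianInt ↦ ‖(((1 + ⟨2, 2⟩ * μ : GaussianInt) : ℂ)) /
        ((((1 + ⟨2, 2⟩ * μ : GaussianInt)).norm : ℤ) : ℂ) *
        ((rexp (-y * ((((1 + ⟨2, 2⟩ * μ : GaussianInt)).norm : ℤ) : ℝ)) : ℝ) : ℂ)‖ := by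
  have hs := (GaussianTheta.summable_exp_neg_mul_norm (c := 4 * y) (by positivity)).mul_left
    (rexp y)
  refine Summable.of_nonneg_of_le (fun _ ↦ norm_nonneg _) (fun μ ↦ ?_) hs
  refine (norm_term_le y _).trans ?_
  rw [← Real.exp_add]
  apply Real.exp_le_exp.mpr
  have := norm_one_add_ge μ
  nlinarith

/-! ### Assembly -/

/-- **`L(E_1, 1)` as an Eisenstein–Kronecker value**: for `E_1 : y² = x³ - x`,

  `L(E_1, 1) = (ζ_{ℤi+ℤ}((1+i)/4) - π(1-i)/4) / (2 - 2i)`,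

`ζ_{ℤi+ℤ}` the Weierstrass zeta function of the Gaussian lattice. (The value of the left side is
`β/4`, `β` the lemniscatic period `∫₁^∞ dx/√(x³-x)`: Birch–Swinnerton-Dyer 1965, Table 1,
`σ(1) = ¼`, via the arithmetic of the lemniscatic Weierstrass functions at the `4`-division point
`(1+i)/4`.) [folklore] -/
theorem entireLFunction_congruentNumberCurve_one_eq :
    (congruentNumberCurve 1).entireLFunction 1 =
      ((ofUpperHalfPlane UpperHalfPlane.I).weierstrassZeta ((1 + I) / 4) - π * ((1 - I) / 4)) /
        (2 - 2 * I) := by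
  -- the two limits of the same function of `y`
  have h1 := tendsto_tsum_heckePsi_one
  have h2 : Tendsto (fun y : ℝ ↦ ∑' x : GaussianInt, heckePsi 1 x * (x : ℂ) / ((x.norm : ℤ) : ℂ) *
      ((rexp (-y * ((x.norm : ℤ) : ℝ)) : ℝ) : ℂ)) (𝓝[>] 0)
      (𝓝 (4 * ((2 - 2 * I)⁻¹ * ((ofUpperHalfPlane UpperHalfPlane.I).weierstrassZeta ((1 + I) / 4) -
        π * ((1 - I) / 4))))) := by
    refine (tendsto_tsum_term_one_add.const_mul 4).congr' ?_
    filter_upwards [self_mem_nhdsWithin] with y (hy : 0 < y)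
    have hsum := summable_norm_term_one_add hy
    have hfold := hasSum_comp_primary (G := fun α : GaussianInt ↦ (α : ℂ) / ((α.norm : ℤ) : ℂ) *
      ((rexp (-y * ((α.norm : ℤ) : ℝ)) : ℝ) : ℂ)) (by simp) hsum.of_norm.hasSum hsum
    rw [← hfold.tsum_eq]
    exact tsum_congr fun x ↦ (heckePsi_one_term_eq y x).symm
  have h := tendsto_nhds_unique h1 h2
  have h4 : (4 : ℂ) ≠ 0 := by norm_num
  have hL := mul_left_cancel₀ h4 h
  rw [hL]
  exact (div_eq_inv_mul _ _).symm

end Literature.NumberTheory.EllipticCurves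

end
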